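import Summits.BirchSwinnertonDyer.Rank1Residual.Partition.CornersLargePrimeThirteen
import Summits.BirchSwinnertonDyer.Rank1Residual.Partition.CornersMultSchneider
import HarnessLib

/-!
# Large primes, BOTH axes, rank `≤ 1`: at `p ≥ 11`, `p ≠ 13`, on 'good ordinary, or multiplicative'
# the only corner — modulo the pair's Schneider certificate when `p` is multiplicative and the rank
# is one — is 'multiplicative without a (ram) witness' (cell `b2b-bsdres`, RESIDUAL-MAP.md §A
# `LARGE PRIMES` + §C `LARGE PRIMES` / `RANK ≤ 1, MODULO THE SCHNEIDER CERTIFICATE`; rmap-1 gen 8)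

HONEST FRAMING (run/shared/lean/b2b/bsd-rank1-residual/, verbatim in every file): the goal of the
cell is to DELETE the COMBINATION-SHAPED residual classes of the Birch–Swinnerton-Dyer formula for
ALL analytic-rank `≤ 1` elliptic curves over `ℚ` — "full BSD formula for every rank `≤ 1` curve in
class `C`" assembled STRICTLY from published theorems — so that the rank-`≤ 1` remainder becomes
exactly the CONSTRUCTION-SHAPED classes, which are TYPED (missing-input `Prop`s), NOT attempted.
This is not "finishing BSD". Theorems only; NO definition, NO named fact introduced here; every
published theorem enters as one of the tree's existing named Literature facts BY NAME; nothing
about any particular curve is asserted; no label changes; nothing is booked by this file; X11a and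
X11b stay CONSTRUCTION-SHAPED (referee A G24), and the certificate clause is, per referee R133.2,
"COMBINATION, certificate-shaped — covered MODULO per-pair Schneider certificates, NOT
COVERED-from-print" (the binders `hSchN` / `hSchS` below are per-pair OPEN hypotheses).

## What this file records

Two large-prime headlines of the block are joined.

* §A (good ordinary), lit-cgls SESSION 9 `Partition/CornersLargePrimeThirteen.lean`:
  `bsdp_goodOrd_of_eleven_le_of_ne_thirteen_sharp` — EVERY `E/ℚ`, `r_an ≤ 1`, good ordinary
  `p ≥ 11`, `p ≠ 13` ⇒ `BSD(E,p)`, NO corner, twelve named facts (the X1 exception set at `p ≥ 11`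
  is `{13}`: A163 = Greenberg LNM 1716 p. 136 puts a reducible good-ordinary `E[p]` at
  `p ∈ {13, 37}` and the `j`-table kills anomaly at `37`).
* §C (multiplicative), this block's `Partition/CornersMultSchneider.lean` over cc-typer-3's
  `X11b/ClassClosureDisegniLever.lean`: at an odd multiplicative `p`, `r_an ≤ 1`, granted the pair's
  Schneider certificate for THE Stein–Wuthrich §4.2 height datum, `BSD(E,p)` unless X11a ∨ X2 ∨
  (X11b ∧ ¬(Ram ∧ (split → `5 ≤ p`))); and `CornersLargePrimeThirteen`'s
  `not_classX2_of_eleven_le_of_ne_thirteen` / `irr_of_mult_of_eleven_le_of_ne_thirteen`: at a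
  multiplicative `p ≥ 11`, `p ≠ 13`, `E[p]` is irreducible (A163 + the `j`-table: no rational
  `37`-isogeny is multiplicative at `37`), so X2 is EMPTY and the split proviso `5 ≤ p` is free.

Hence (this file, theorems only, NO new fact, every published theorem one of the tree's named
Literature facts BY NAME — nineteen of them in the joint form):

* `bsdp_mult_of_eleven_le_of_ne_thirteen_of_ram_of_schneider` — multiplicative `p ≥ 11`, `p ≠ 13`,
  `r_an ≤ 1`, a (ram) witness, and — ONLY when `r_an = 1` — the pair's Schneider certificate ⇒
  `BSD(E,p)` (rank `0`: Skinner 2016 Thm C, no certificate; rank `1`: the lever — Skinner 2016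
  Thm A, Stein–Wuthrich 2013 Thm 6.1 / §4.2, Disegni 2020 Thm 1 = registry A183 (on the irreducible
  class X11b a variant derived from the exact Thm 4 clauses A185/A186, referee R133.3), GZK,
  modularity);
* `corner_iff_of_mult_of_eleven_le_of_ne_thirteen` — in the block's class vocabulary the corner
  'Mult ∧ ¬Ram' at `r_an ≤ 1`, `p ≥ 11`, `p ≠ 13` IS `X11a ∨ (X11b ∧ ¬Ram)`;
* `bsdp_goodOrd_or_mult_of_eleven_le_of_ne_thirteen_of_schneider` — **EVERY `E/ℚ` (CM included),
  `r_an ≤ 1`, every prime `p ≥ 11` other than `13` of good ORDINARY or MULTIPLICATIVE reduction: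
  `BSD(E,p)` holds — modulo the pair's Schneider certificate when `p` is multiplicative and
  `r_an = 1` — unless `p` is multiplicative and NO other multiplicative prime `q` has `E[p]`
  ramified at `q` (no (ram) witness)**; nineteen named facts;
* `bsdp_or_corner_of_eleven_le_of_ne_thirteen_of_schneider` — the same as a partition statement:
  `BSD(E,p) ∨ (Mult ∧ ¬Ram)`.

For the RESIDUAL-MAP: on `D ∩ {p ≥ 11, p ≠ 13}` with 'good ordinary ∨ multiplicative' the joint
corner predicate modulo the certificate is `CORNER(W, p) := Mult W p ∧ ¬ Ram W p` (= K11a ∨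
(K11b ∧ ¬ram)); without the certificate the §C large-prime form of gen 4 stands (K11a ∨ K11b).
Supersingular and additive `p` are not on this domain (§B, §D–§G are other seats' sections).
Reading flags that travel with the inputs (HYPOTHESES.md / CITED-FACTS.md, not re-argued here):
`BCS25-IMC-equiv@BSTW` on `hBCS`; `GV00-mult-asserted` is NOT used here; on the lever
`Dis20-Thm1-split-Venerucci-irred` (harmless on X11b) and `Dis20-height-identification-reading`
(Disegni's height = Nekovář's = Schneider's / Mazur–Tate's at a non-exceptional `p`: Disegni,
Compositio Math. 153 (2017), p. 7; Disegni, Kyoto J. Math. 60 (2020), §1.1.3 (b) and §2.1 — the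
extended regulator coincides with Mazur–Tate–Teitelbaum's when `S_p^exc = ∅`).

References: `Partition/CornersLargePrimeThirteen.lean` (lit-cgls S9, p250961),
`Partition/CornersLargePrime.lean` (rmap-1 g4), `Partition/CornersMultSchneider.lean` (rmap-1 g8,
p250379 / p251532), `X11b/ClassClosureDisegniLever.lean` (cc-typer-3, p249340); RESIDUAL-MAP.md §A,
§C, §I N7/N8; referee R133.2 (HOME/REFEREE.md gen 129); [Skinner2016PacificMC] Thm. A, Thm. C;
[SteinWuthrich2013] Thm. 6.1, §4.2; [Disegni2020] Thm. 1, Thm. 4, §1.1.3; [GreenbergLNM1716] §5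
p. 136; [Mazur1978] table p. 129; [CremonaAlgorithms1997] §3.8 p. 82;
[BurungaleCastellaSkinner2025] Cor. 1.3.1; [CastellaGrossiSkinner2025] Thm. D.
-/

namespace Summit.BirchSwinnertonDyer.Rank1Residual

open WeierstrassCurve Literature.NumberTheory.EllipticCurves
  Literature.NumberTheory.EllipticCurves.Rank1Residual Literature.NumberTheory.EllipticCurves.ModularForms
  Literature.NumberTheory.EllipticCurves.Greenberg1999
  Literature.NumberTheory.EllipticCurves.Rank1Residual.Typed
  Literature.NumberTheory.EllipticCurves.Skinner2016
  Literature.NumberTheory.EllipticCurves.SteinWuthrich2013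
  Literature.NumberTheory.EllipticCurves.Disegni2020
open scoped NumberField ModularForm

section Curve

variable {W : WeierstrassCurve ℚ} [W.IsElliptic] [W.IsGloballyMinimal] {p : ℕ} [Fact p.Prime]

/-! ### The multiplicative axis at `p ≥ 11`, `p ≠ 13`, both ranks -/

/-- **Multiplicative `p ≥ 11`, `p ≠ 13`, analytic rank `≤ 1`, a (ram) witness ⇒ `BSD(E,p)` — with
the pair's Schneider certificate (THE Stein–Wuthrich §4.2 datum, non-split / split shapes) required
ONLY in rank one.** Rank `0`: Skinner 2016 Thm C (`bsdp_mult_rankZero_of_eleven_le_of_ram_of_ne_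
thirteen`, irreducibility automatic). Rank `1`: the pair is X11b (irreducible by
`irr_of_mult_of_eleven_le_of_ne_thirteen`) and the lever `bsdp_of_classX11b_of_ram_of_schneider`
applies, its split proviso `5 ≤ p` being free at `p ≥ 11`. Tier (referee R133.2): certificate-shaped,
NOT covered-from-print. [cite: Skinner2016PacificMC, Thm. A and Thm. C]
[cite: SteinWuthrich2013, Thm. 6.1 and §4.2] [cite: Disegni2020, Thm. 1]
[cite: GreenbergLNM1716, §5 p. 136] [cite: CremonaAlgorithms1997, §3.8 p. 82] -/
theorem bsdp_mult_of_eleven_le_of_ne_thirteen_of_ram_of_schneider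
    (hSk : Skinner2016.thmC_padicValRat_bsd_rank_zero)
    (hmod : hasEntireLFunction_rat) (hGZK : rank_eq_analyticRank_of_analyticRank_le_one)
    (hmodP : nonempty_modularParametrizationData)
    (hGr136 : p136_mem_isogenyPrimes_of_reducible) (hT : primeDegreeIsogeny_jTable)
    (hA : thmA_charIdeal_multiplicative)
    (hJn : thm61_nonsplitMultiplicative) (hJs : thm61_splitMultiplicative)
    (hHn : exists_isMultCanonical) (hHs : exists_isSplitMultCanonical)
    (hD : thm1_padicBSD_rankOne_multiplicative)
    (hm : Mult W p) (hr : W.analyticRank ≤ 1) (h11 : 11 ≤ p) (h13 : p ≠ 13) (hram : Ram W p)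
    (hSchN : W.analyticRank = 1 → ∀ (q : ℚ_[p]) (Dh : PAdicHeightData W p), q ≠ 0 → ‖q‖ < 1 →
      tateJ q = (W.j : ℚ_[p]) → IsMultCanonical Dh q → SchneiderConjecture Dh)
    (hSchS : W.analyticRank = 1 → ∀ (Dq : TateParameterData W p) (Dh : PAdicHeightData W p),
      IsSplitMultCanonical Dh Dq → SchneiderConjecture Dh) : BSDp W p := by
  rcases Nat.lt_or_ge W.analyticRank 1 with h0 | h1
  · exact bsdp_mult_rankZero_of_eleven_le_of_ram_of_ne_thirteen hSk hmod hGZK hGr136 hT hm (by omega)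
      h11 h13 hram
  · have hr1 : W.analyticRank = 1 := le_antisymm hr h1
    have hX : ClassX11b W p :=
      ⟨hr1, by omega, hm, irr_of_mult_of_eleven_le_of_ne_thirteen hGr136 hT hm h11 h13⟩
    exact bsdp_of_classX11b_of_ram_of_schneider hA hJn hJs hHn hHs hD hGZK hmodP hX hram
      (fun _ => by omega) (hSchN hr1) (hSchS hr1)

/-- **The corner in the block's class vocabulary.** At a multiplicative-or-not prime `p ≥ 11`,
`p ≠ 13`, in analytic rank `≤ 1`: 'multiplicative without a (ram) witness' is exactly
`X11a ∨ (X11b ∧ ¬Ram)` (irreducibility of `E[p]` at a multiplicative `p ≥ 11`, `p ≠ 13` is automatic: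
A163 + the `j`-table). [cite: GreenbergLNM1716, §5 p. 136] [cite: CremonaAlgorithms1997, §3.8 p. 82] -/
theorem corner_iff_of_mult_of_eleven_le_of_ne_thirteen
    (hGr136 : p136_mem_isogenyPrimes_of_reducible) (hT : primeDegreeIsogeny_jTable)
    (hr : W.analyticRank ≤ 1) (h11 : 11 ≤ p) (h13 : p ≠ 13) :
    (Mult W p ∧ ¬ Ram W p) ↔ (ClassX11a W p ∨ (ClassX11b W p ∧ ¬ Ram W p)) := by
  constructor
  · rintro ⟨hm, hnr⟩
    have hirr := irr_of_mult_of_eleven_le_of_ne_thirteen hGr136 hT hm h11 h13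
    rcases Nat.lt_or_ge W.analyticRank 1 with h0 | h1
    · exact Or.inl ⟨by omega, by omega, hm, hirr, hnr⟩
    · exact Or.inr ⟨⟨le_antisymm hr h1, by omega, hm, hirr⟩, hnr⟩
  · rintro (⟨-, -, hm, -, hnr⟩ | ⟨⟨-, -, hm, -⟩, hnr⟩)
    · exact ⟨hm, hnr⟩
    · exact ⟨hm, hnr⟩

/-! ### Both axes at `p ≥ 11`, `p ≠ 13` -/

/-- **LARGE PRIMES, BOTH AXES, rank `≤ 1`, modulo the certificate: NINETEEN named facts.** For
EVERY `E/ℚ` (CM included) of analytic rank `≤ 1` and EVERY prime `p ≥ 11` with `p ≠ 13` at which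
`E` has good ORDINARY or MULTIPLICATIVE reduction, `BSD(E,p)` holds — granted, when `p` is
multiplicative and the rank is one, the pair's Schneider certificate — unless `p` is multiplicative
and there is no (ram) witness (no multiplicative `q ≠ p` with `E[p]` ramified at `q`). Good ordinary
side: `bsdp_goodOrd_of_eleven_le_of_ne_thirteen_sharp` (twelve facts, NO corner, no certificate);
multiplicative side: `bsdp_mult_of_eleven_le_of_ne_thirteen_of_ram_of_schneider`. Tier of the
certificate clause (referee R133.2): certificate-shaped, NOT covered-from-print; nothing booked.
[cite: BurungaleCastellaSkinner2025, Cor. 1.3.1] [cite: CastellaGrossiSkinner2025, Theorem D]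
[cite: Skinner2016PacificMC, Thm. A and Thm. C] [cite: SteinWuthrich2013, Thm. 6.1 and §4.2]
[cite: Disegni2020, Thm. 1] [cite: GreenbergLNM1716, Thm. 4.1 and §5 p. 136]
[cite: MazurSwinnertonDyer1974, §5] [cite: CremonaAlgorithms1997, §3.8 p. 82] -/
theorem bsdp_goodOrd_or_mult_of_eleven_le_of_ne_thirteen_of_schneider
    (hBCS : BurungaleCastellaSkinner2025.cor131_padicValRat_bsd_rank_le_one)
    (hGZK : rank_eq_analyticRank_of_analyticRank_le_one)
    (hBDMTV : BalakrishnanEtAl2019.thm12_not_le_normalizer_splitCartan)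
    (hCM : bsdTriple_of_hasCM_of_L_one_ne_zero) (hKob : Kobayashi2013.cor14_bsdp_of_cm_rank_one)
    (hmod : hasEntireLFunction_rat) (hmodP : nonempty_modularParametrizationData)
    (hCGS : CastellaGrossiSkinner2025.thmD_padicValRat_bsd_rank_le_one)
    (hGV : GreenbergVatsal2000.thm13_charIdeal_eq_of_gvPar) (hGr : greenberg_charValue_rankZero)
    (hGr136 : p136_mem_isogenyPrimes_of_reducible) (hT : primeDegreeIsogeny_jTable)
    (hSk : Skinner2016.thmC_padicValRat_bsd_rank_zero) (hA : thmA_charIdeal_multiplicative)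
    (hJn : thm61_nonsplitMultiplicative) (hJs : thm61_splitMultiplicative)
    (hHn : exists_isMultCanonical) (hHs : exists_isSplitMultCanonical)
    (hD : thm1_padicBSD_rankOne_multiplicative)
    (hr : W.analyticRank ≤ 1) (hred : GoodOrd W p ∨ Mult W p) (h11 : 11 ≤ p) (h13 : p ≠ 13)
    (hram : Mult W p → Ram W p)
    (hSchN : Mult W p → W.analyticRank = 1 → ∀ (q : ℚ_[p]) (Dh : PAdicHeightData W p), q ≠ 0 →
      ‖q‖ < 1 → tateJ q = (W.j : ℚ_[p]) → IsMultCanonical Dh q → SchneiderConjecture Dh)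
    (hSchS : Mult W p → W.analyticRank = 1 → ∀ (Dq : TateParameterData W p)
      (Dh : PAdicHeightData W p), IsSplitMultCanonical Dh Dq → SchneiderConjecture Dh) :
    BSDp W p := by
  rcases hred with hgo | hm
  · exact bsdp_goodOrd_of_eleven_le_of_ne_thirteen_sharp hBCS hGZK hBDMTV hCM hKob hmod hmodP hCGS
      hGV hGr hGr136 hT hr hgo h11 h13
  · exact bsdp_mult_of_eleven_le_of_ne_thirteen_of_ram_of_schneider hSk hmod hGZK hmodP hGr136 hT hA
      hJn hJs hHn hHs hD hm hr h11 h13 (hram hm) (hSchN hm) (hSchS hm)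

/-- **Partition form at `p ≥ 11`, `p ≠ 13`, both axes, rank `≤ 1`:** `BSD(E,p)`, or the pair is
'multiplicative without a (ram) witness' (= X11a ∨ (X11b ∧ ¬Ram),
`corner_iff_of_mult_of_eleven_le_of_ne_thirteen`) — modulo the certificate on the multiplicative
rank-one pairs. [cite: BurungaleCastellaSkinner2025, Cor. 1.3.1]
[cite: Skinner2016PacificMC, Thm. A and Thm. C] [cite: Disegni2020, Thm. 1]
[cite: GreenbergLNM1716, §5 p. 136] -/
theorem bsdp_or_corner_of_eleven_le_of_ne_thirteen_of_schneider
    (hBCS : BurungaleCastellaSkinner2025.cor131_padicValRat_bsd_rank_le_one)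
    (hGZK : rank_eq_analyticRank_of_analyticRank_le_one)
    (hBDMTV : BalakrishnanEtAl2019.thm12_not_le_normalizer_splitCartan)
    (hCM : bsdTriple_of_hasCM_of_L_one_ne_zero) (hKob : Kobayashi2013.cor14_bsdp_of_cm_rank_one)
    (hmod : hasEntireLFunction_rat) (hmodP : nonempty_modularParametrizationData)
    (hCGS : CastellaGrossiSkinner2025.thmD_padicValRat_bsd_rank_le_one)
    (hGV : GreenbergVatsal2000.thm13_charIdeal_eq_of_gvPar) (hGr : greenberg_charValue_rankZero)
    (hGr136 : p136_mem_isogenyPrimes_of_reducible) (hT : primeDegreeIsogeny_jTable)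
    (hSk : Skinner2016.thmC_padicValRat_bsd_rank_zero) (hA : thmA_charIdeal_multiplicative)
    (hJn : thm61_nonsplitMultiplicative) (hJs : thm61_splitMultiplicative)
    (hHn : exists_isMultCanonical) (hHs : exists_isSplitMultCanonical)
    (hD : thm1_padicBSD_rankOne_multiplicative)
    (hr : W.analyticRank ≤ 1) (hred : GoodOrd W p ∨ Mult W p) (h11 : 11 ≤ p) (h13 : p ≠ 13)
    (hSchN : Mult W p → W.analyticRank = 1 → ∀ (q : ℚ_[p]) (Dh : PAdicHeightData W p), q ≠ 0 →
      ‖q‖ < 1 → tateJ q = (W.j : ℚ_[p]) → IsMultCanonical Dh q → SchneiderConjecture Dh)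
    (hSchS : Mult W p → W.analyticRank = 1 → ∀ (Dq : TateParameterData W p)
      (Dh : PAdicHeightData W p), IsSplitMultCanonical Dh Dq → SchneiderConjecture Dh) :
    BSDp W p ∨ (Mult W p ∧ ¬ Ram W p) := by
  by_cases hc : Mult W p ∧ ¬ Ram W p
  · exact Or.inr hc
  · refine Or.inl (bsdp_goodOrd_or_mult_of_eleven_le_of_ne_thirteen_of_schneider hBCS hGZK hBDMTV
      hCM hKob hmod hmodP hCGS hGV hGr hGr136 hT hSk hA hJn hJs hHn hHs hD hr hred h11 h13
      (fun hm => ?_) hSchN hSchS)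
    by_contra hnr
    exact hc ⟨hm, hnr⟩

end Curve

end Summit.BirchSwinnertonDyer.Rank1Residual
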